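import Literature.RepresentationTheory.HeisenbergGroup.DualLatticePairNonarchRankOne
import Literature.RepresentationTheory.HeisenbergGroup.DualLatticePairRestrictedProduct
import Literature.RepresentationTheory.HeisenbergGroup.DualLatticePairPi
import HarnessLib

/-!
# The finite-adelic dual lattice pair from local data: `(∏_v 𝒪_vⁿ, ∏_v 𝔠_vⁿ)` for `ψ_fin = ∏_v ψ_v` on a restricted
# product of non-archimedean fields

Topic `RepresentationTheory/HeisenbergGroup`; namespace `Literature.RepresentationTheory.HeisenbergGroup`.  KERNEL ONLY:
theorems; no definition, no named fact, no record, no `sorry`.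

Assembly of `DualLatticePairNonarchRankOne.lean` (the local pairs `(𝒪_v, 𝔠_v)`), `DualLatticePairRestrictedProduct.lean`
(restricted products) and `DualLatticePairPi.lean` (boxes in rank `n`): for a family of non-archimedean normed fields
`F_v` with compact closed balls and non-zero elements of norm `< 1`, open subrings `A_v` equal to the closed unit balls,
and continuous non-trivial characters `ψ_v` trivial on `A_v` and UNRAMIFIED (`𝔠_{ψ_v} = 𝒪_v`) for almost all `v` — the
classical hypotheses on the local components of an adelic character ([Weil1964, Chap. III n° 37–39]; [Bump1997, §3.1]) —
the restricted product `P = Πʳ_v [F_v, A_v]` (the shape of `𝐀_fin`) carries the character `∏ψ_v` and: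

* §1 `eventually_apply_eq_one_of_unramified` (unramified a.e. ⇒ `ψ_v(𝒪_v) = 1` a.e., the hypothesis of `prodChar`);
  **`isDualLatticePair_integers_conductor`**: `(∏_v 𝒪_v, ∏_v 𝔠_v)` is a dual lattice pair for `(s, t) ↦ (∏ψ)(s t)`
  on `P × P`, and the unit scalings of both shrink to `0` (`exists_units_smul_integers_subset`,
  `exists_units_smul_conductor_subset`);
* §2 **`isDualLatticePair_integers_conductor_pi`**: the boxes `((∏𝒪_v)ⁿ, (∏𝔠_v)ⁿ)` form a dual lattice pair for the
  dot product `(∏ψ)(x · y)` on `Pⁿ × Pⁿ`, with shrinking unit scalings — exactly the input `(hB, hX, hY)` of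
  `StoneVonNeumannLatticePair.exists_linearIsometryEquiv_of_irreducible_of_isDualLatticePair`, of
  `StoneVonNeumannLatticePairSchur` and of `HeisenbergPairUniqueness.exists_linearIsometryEquiv_of_irreducible_heisenberg_pair`
  for the finite-adelic Heisenberg group in a Darboux basis.

Nothing of the cited sources is asserted; everything is proved from Mathlib and the tree.

## References
* [Weil1964] A. Weil, Acta Math. 111 (1964), Chap. III n° 37–39.
* [Bump1997] D. Bump, *Automorphic Forms and Representations*, CUP (1997), §3.1.
-/

set_option autoImplicit false

noncomputable section

open Set Filter Topology Function
open scoped Pointwise RestrictedProduct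

namespace Literature.RepresentationTheory.HeisenbergGroup

open RestrictedPair

variable {ι : Type*} {F : ι → Type*} [∀ i, NormedField (F i)] [∀ i, IsUltrametricDist (F i)] [∀ i, ProperSpace (F i)]
  {S : ι → Type*} [∀ i, SetLike (S i) (F i)] [∀ i, SubringClass (S i) (F i)] {A : ∀ i, S i}
  (hA : ∀ i, (A i : Set (F i)) = Metric.closedBall 0 1)
  (ψ : ∀ i, AddChar (F i) Circle) (hψc : ∀ i, Continuous (ψ i)) (hψ1 : ∀ i, ∃ t, ψ i t ≠ 1)
  (hψA : ∀ᶠ i in cofinite, ∀ a ∈ A i, ψ i a = 1)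
  (hunr : ∀ᶠ i in cofinite, (mulDual (ψ i) : Set (F i)) = Metric.closedBall 0 1)
  (hsmall : ∀ i, ∃ c : F i, 0 < ‖c‖ ∧ ‖c‖ < 1)

/-! ## §1 The rank-one finite-adelic pair `(∏ 𝒪_v, ∏ 𝔠_v)` -/

include hA hunr in
omit [∀ i, IsUltrametricDist (F i)] [∀ i, ProperSpace (F i)] [∀ i, SubringClass (S i) (F i)] in
/-- an unramified local character is trivial on the integers (`1 ∈ 𝒪 = 𝔠_ψ`); so the hypothesis "`ψ_v(A_v) = 1` for almost
all `v`" of `RestrictedPair.prodChar` follows from unramifiedness almost everywhere. [cite: Weil1964, Chap. III n° 38] -/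
theorem eventually_apply_eq_one_of_unramified : ∀ᶠ i in cofinite, ∀ a ∈ A i, ψ i a = 1 := by
  refine hunr.mono fun i hi a ha => ?_
  have ha1 : ‖a‖ ≤ 1 := by
    rw [← mem_closedBall_zero_iff, ← hA i]
    exact ha
  have h1 : (1 : F i) ∈ mulDual (ψ i) := by
    rw [← SetLike.mem_coe, hi, mem_closedBall_zero_iff, norm_one]
  have h := h1 a ha1
  rwa [mul_one] at h

include hA in
omit [∀ i, ProperSpace (F i)] [∀ i, SubringClass (S i) (F i)] in
/-- the structure subrings are open. [cite: Weil1964, Chap. III n° 37] -/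
theorem isOpen_structureSubring (i : ι) : IsOpen (A i : Set (F i)) := by
  rw [hA i]
  exact IsUltrametricDist.isOpen_closedBall _ one_ne_zero

include hA hψc hψ1 hunr in
/-- **the finite-adelic rank-one dual lattice pair**: `(∏_v 𝒪_v, ∏_v 𝔠_{ψ_v})` is a dual lattice pair for
`(s, t) ↦ (∏_v ψ_v)(s t)` on the restricted product. [cite: Weil1964, Chap. III n° 37–39] -/
theorem isDualLatticePair_integers_conductor [DecidableEq ι] :
    IsDualLatticePair (LinearMap.mul (Πʳ i, [F i, A i]) (Πʳ i, [F i, A i])) (prodChar ψ hψA)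
      (box (A := A) fun i => (IsUltrametricDist.closedBall_openAddSubgroup (F i) one_pos).toAddSubgroup)
      (box (A := A) fun i => mulDual (ψ i)) :=
  isDualLatticePair_box ψ hψA (isOpen_structureSubring hA)
    (fun i => isDualLatticePair_unitBall_mulDual (ψ i) (hψc i) (hψ1 i))
    (Filter.Eventually.of_forall fun i => (hA i).symm)
    (hunr.mono fun i hi => by rw [hi, hA i])

include hA hsmall in
omit [∀ i, ProperSpace (F i)] in
/-- the unit scalings of `∏_v 𝒪_v` shrink to `0`. [cite: Weil1964, Chap. III n° 37–39] -/
theorem exists_units_smul_integers_subset (N : Set (Πʳ i, [F i, A i])) (hN : N ∈ 𝓝 (0 : Πʳ i, [F i, A i])) :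
    ∃ u : (Πʳ i, [F i, A i])ˣ, (((u : Πʳ i, [F i, A i]) •
      box (A := A) (fun i => (IsUltrametricDist.closedBall_openAddSubgroup (F i) one_pos).toAddSubgroup) :
        AddSubgroup (Πʳ i, [F i, A i])) : Set (Πʳ i, [F i, A i])) ⊆ N :=
  exists_units_smul_box_subset (isOpen_structureSubring hA) _ (Filter.Eventually.of_forall fun i => (hA i).symm)
    (fun i V hV => by
      obtain ⟨u, hu⟩ := exists_units_smul_unitBall_subset (hsmall i) V hV
      exact ⟨u, by rwa [AddSubgroup.coe_pointwise_smul] at hu⟩)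
    N hN

include hA hψc hψ1 hunr hsmall in
/-- the unit scalings of `∏_v 𝔠_v` shrink to `0`. [cite: Weil1964, Chap. III n° 37–39] -/
theorem exists_units_smul_conductor_subset (N : Set (Πʳ i, [F i, A i])) (hN : N ∈ 𝓝 (0 : Πʳ i, [F i, A i])) :
    ∃ u : (Πʳ i, [F i, A i])ˣ, (((u : Πʳ i, [F i, A i]) • box (A := A) (fun i => mulDual (ψ i)) :
      AddSubgroup (Πʳ i, [F i, A i])) : Set (Πʳ i, [F i, A i])) ⊆ N :=
  exists_units_smul_box_subset (isOpen_structureSubring hA) _ (hunr.mono fun i hi => by rw [hi, hA i])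
    (fun i V hV => by
      obtain ⟨u, hu⟩ := exists_units_smul_mulDual_subset (ψ i) (hψc i) (hψ1 i) (hsmall i) V hV
      exact ⟨u, by rwa [AddSubgroup.coe_pointwise_smul] at hu⟩)
    N hN

/-! ## §2 The finite-adelic pair in rank `n`: the input of the Stone–von Neumann lattice-pair files -/

include hA hψc hψ1 hunr in
/-- **the finite-adelic dual lattice pair in a Darboux basis**: `((∏𝒪_v)ⁿ, (∏𝔠_v)ⁿ)` is a dual lattice pair for the
dot product `(∏ψ)(x · y)` on `Pⁿ × Pⁿ`. [cite: Weil1964, Chap. III n° 37–39] -/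
theorem isDualLatticePair_integers_conductor_pi [DecidableEq ι] {n : Type*} [Fintype n] [DecidableEq n] :
    IsDualLatticePair (Matrix.toLinearMap₂' (Πʳ i, [F i, A i]) (1 : Matrix n n (Πʳ i, [F i, A i]))) (prodChar ψ hψA)
      (AddSubgroup.pi Set.univ fun _ : n =>
        box (A := A) fun i => (IsUltrametricDist.closedBall_openAddSubgroup (F i) one_pos).toAddSubgroup)
      (AddSubgroup.pi Set.univ fun _ : n => box (A := A) fun i => mulDual (ψ i)) :=
  (isDualLatticePair_integers_conductor hA ψ hψc hψ1 hψA hunr).pi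

include hA hsmall in
omit [∀ i, ProperSpace (F i)] in
/-- the unit scalings of `(∏𝒪_v)ⁿ` shrink to `0` — hypothesis `hX` of the lattice-pair uniqueness theorems.
[cite: Weil1964, Chap. III n° 37–39] -/
theorem exists_units_smul_integers_pi_subset {n : Type*} [Fintype n] (N : Set (n → Πʳ i, [F i, A i]))
    (hN : N ∈ 𝓝 (0 : n → Πʳ i, [F i, A i])) :
    ∃ u : (Πʳ i, [F i, A i])ˣ, (((u : Πʳ i, [F i, A i]) • AddSubgroup.pi Set.univ (fun _ : n =>
      box (A := A) fun i => (IsUltrametricDist.closedBall_openAddSubgroup (F i) one_pos).toAddSubgroup) :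
        AddSubgroup (n → Πʳ i, [F i, A i])) : Set (n → Πʳ i, [F i, A i])) ⊆ N :=
  exists_units_smul_pi_subset _ (exists_units_smul_integers_subset hA hsmall) N hN

include hA hψc hψ1 hunr hsmall in
/-- the unit scalings of `(∏𝔠_v)ⁿ` shrink to `0` — hypothesis `hY` of the lattice-pair uniqueness theorems.
[cite: Weil1964, Chap. III n° 37–39] -/
theorem exists_units_smul_conductor_pi_subset {n : Type*} [Fintype n] (N : Set (n → Πʳ i, [F i, A i]))
    (hN : N ∈ 𝓝 (0 : n → Πʳ i, [F i, A i])) :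
    ∃ u : (Πʳ i, [F i, A i])ˣ, (((u : Πʳ i, [F i, A i]) • AddSubgroup.pi Set.univ (fun _ : n =>
      box (A := A) fun i => mulDual (ψ i)) : AddSubgroup (n → Πʳ i, [F i, A i])) : Set (n → Πʳ i, [F i, A i])) ⊆ N :=
  exists_units_smul_pi_subset _ (exists_units_smul_conductor_subset hA ψ hψc hψ1 hunr hsmall) N hN

end Literature.RepresentationTheory.HeisenbergGroup

end
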